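/-
Copyright (c) 2026. All rights reserved.
Released under Apache 2.0 license as described in the file LICENSE.
Authors: abc-iut cell — seat abc-iut-w5-d058 (wave 5; §4(iii) non-vacuity programme, layer L4: the `T`-pair layer
of [AbsTopIII] §5 over the trivial-group context — `GlobalTPair.Hom`, `PanalocalReconstruction`, and the named facts
of `TPairs.lean` at a degenerate vocabulary).
-/
import Mathlib.Algebra.Module.PUnit
import Literature.AnabelianGeometry.AbsoluteAnabelian.PanalocalTPairs
import Literature.AnabelianGeometry.AbsoluteAnabelian.GaloisTheatersTrivialContext
import HarnessLib

/-!
# [AbsTopIII] §5 `T`-pairs: a restricted identity morphism, and the Cor 5.2 (ii)–(iv), (vi), (vii) named facts at a degenerate vocabulary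

S. Mochizuki, *Topics in absolute anabelian geometry III* [MochizukiAbsTopIII2015], Def 5.1 (v)–(vi) pp. 116–118,
Cor 5.2 (ii)–(iv) pp. 119–120, Rmk 5.2.3 p. 121, Cor 5.2 (vi)–(vii) pp. 120–121.

Companion of `GaloisTheatersNonVacuity.lean` (degenerate context / vocabulary) and `GaloisTheatersTrivialContext.lean`
(the trivial-group context and the §5 theater facts).  PROOF-ONLY (no `def` / `instance` / `structure` / notation):

* `GlobalTPair.nonempty_hom_self_of_forall_notMem_arc` — GENERIC (every `R`, `W`): a global `T`-pair WITHOUT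
  archimedean elements carries its identity endomorphism (identity theater morphism, `φ⊚ := 𝟙`, `φ_v := 𝟙`; conditions
  (a)(b)(d) by `Category.comp_id` / `Functor.map_id`, (c) vacuous).  As for theaters (interface note I-L4-t3-1), at an
  archimedean `v` the identity would need `R.mapKNF (𝟙 Π) = id`, not asserted by the context record.
* `TPairVocabulary.exists_degenerate_tpairFacts` — for EVERY context `R` whose canonical pro-sets are one-point with
  no local elements (e.g. the trivial-group context of `GlobalAnabelianContext.exists_trivialGroupContext`) and every
  `T`, the DEGENERATE vocabulary `W₀` (`T = T⊚ := Type u`, data `PUnit`, predicates `⊤`, trivial cyclotomes) carries a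
  `PanalocalReconstruction A₀` (zero row of the L4 census) and satisfies SIMULTANEOUSLY the named facts
  `CyclotomeIsoUnique` (Cor 5.2 (ii), F-0186), `ReferencePairIsoUnique` (Cor 5.2 (iii), F-0189),
  `TPairHomDeterminedByTheaterHom` (Cor 5.2 (iii), F-0191), `TPairIsoCanonical` (Cor 5.2 (iv), F-0192),
  `TPairEAHomExtends` (Cor 5.2 (iv), F-0190) for `T ≠ TLG`, `CyclotomeIsoViaArchimedean` (Rmk 5.2.3, F-0187) for
  `T = TLG`, `Cor52vi` (= `PanalocalTPairExists ∧ PanalocalTPairMapsHom ∧ PanalocalTPairEssSurj`, F-3085–F-3087 /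
  F-3092) and `Cor52vii W₀ A₀` (= `PanalocalTPairIsoCanonical ∧ PanalocalTPairHomDetermined ∧ PanalocalTheaterHomLifts`,
  F-3088–F-3091) for `T ≠ TLG`; `TPairVocabulary.exists_context_tpairFacts` instantiates it at the trivial-group context
  (with `Ob(EA⊚)` and `GlobalTPair W₀` inhabited).

HONEST LABEL (binding, abc-iut-L4-lead RULING #5a (6)): SATISFIABILITY witnesses at a degenerate vocabulary over an
archimedean-free one-point context, NOT discharges of the named facts at the intended model (they stay fact-open
there; FACT policy).  Nothing of [AbsTopIII] is asserted; instantiated ≠ endorsed; nothing here bears on the disputed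
[IUTchIII] Cor. 3.12.
-/

namespace Literature.AnabelianGeometry.AbsoluteAnabelian

open CategoryTheory Topology

universe u

section

variable {R : GlobalAnabelianContext.{u}} {T : TKind} (W : TPairVocabulary R T)

/-- **A global `T`-pair without archimedean elements has an identity endomorphism** (identity theater morphism,
`φ⊚ := 𝟙_{M⊚}`, `φ_v := 𝟙_{M_v}`). [cite: MochizukiAbsTopIII2015, Def 5.1 (v) p. 117] -/
theorem GlobalTPair.nonempty_hom_self_of_forall_notMem_arc (P : GlobalTPair W)
    (harc : ∀ v, v ∉ P.theater.V.arc) : Nonempty (GlobalTPair.Hom W P P) :=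
  ⟨{ φV :=
       { φgrp := 𝟙 P.theater.ext
         isEAHom := isEAHom_id P.theater.ext
         φV := Homeomorph.refl _
         φV_smul := fun _ _ => rfl
         φV_generic := rfl
         image_non := Set.image_id _
         image_arc := Set.image_id _
         arch_compat := fun v _ => (harc v v.2).elim }
     φM := Iso.refl _
     φM_equivariant := fun g => by
       change (P.act g).hom ≫ 𝟙 _ = 𝟙 _ ≫ (P.act g).hom
       rw [Category.comp_id, Category.id_comp]
     non_mem := fun v => v.2
     arc_mem := fun v => v.2
     φnon := fun _ => Iso.refl _
     φnon_equivariant := fun v g hg hg' => by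
       change (P.actNon v ⟨g, hg⟩).hom ≫ 𝟙 _ = 𝟙 _ ≫ (P.actNon v ⟨g, hg'⟩).hom
       rw [Category.comp_id, Category.id_comp]
     φarc := fun v => (harc v v.2).elim
     φarc_kummer := fun v => (harc v v.2).elim
     ρnon_comm := fun v => by
       change P.ρnon v ≫ W.toGlob.map (𝟙 (P.Mnon v)) = 𝟙 _ ≫ P.ρnon v
       rw [CategoryTheory.Functor.map_id, Category.comp_id, Category.id_comp]
     ρarc_comm := fun v => (harc v v.2).elim }⟩

end

/-- Over a context without nonarchimedean / archimedean elements, a global Galois-theater has none either (its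
reference isomorphism maps `V(Π)^non` ONTO `V̄^non`, `V(Π)^arc` onto `V̄^arc`). [cite: MochizukiAbsTopIII2015, Def 5.1 (iii) p. 115] -/
theorem GlobalGaloisTheater.forall_notMem_of_forall_notMem {R : GlobalAnabelianContext.{u}}
    (hnon : ∀ E v, v ∉ (R.proVal E).non) (harc : ∀ E v, v ∉ (R.proVal E).arc) (T₀ : GlobalGaloisTheater R) :
    (∀ v, v ∉ T₀.V.non) ∧ ∀ v, v ∉ T₀.V.arc := by
  obtain ⟨ψ, -, -, hn, ha, -⟩ := T₀.exists_referenceIso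
  refine ⟨fun v hv => ?_, fun v hv => ?_⟩
  · rw [← hn] at hv
    obtain ⟨w, hw, -⟩ := hv
    exact hnon _ w hw
  · rw [← ha] at hv
    obtain ⟨w, hw, -⟩ := hv
    exact harc _ w hw

/-- **The `T`-pair named facts of [AbsTopIII] Cor 5.2 (ii)–(iv), (vi), (vii) / Rmk 5.2.3 are JOINTLY SATISFIABLE at the
degenerate vocabulary** over every context with one-point canonical pro-sets and no local elements (e.g. the
trivial-group context): the vocabulary `W₀` (`T = T⊚ := Type u`, identity functor, data `PUnit`, predicates `⊤`,
trivial cyclotomes, no `Z`-indices) carries the reconstruction datum `A₀` (all data `PUnit`), and `CyclotomeIsoUnique`,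
`ReferencePairIsoUnique`, `TPairHomDeterminedByTheaterHom`, `TPairIsoCanonical`, `TPairEAHomExtends`, `Cor52vii W₀ A₀`
(`T ≠ TLG`), `CyclotomeIsoViaArchimedean` (`T = TLG`) and `Cor52vi W₀` all hold.  SATISFIABILITY witness at a
DEGENERATE model, NOT a discharge of the facts at the intended model. [cite: MochizukiAbsTopIII2015, Cor 5.2 (ii)–(vii) pp. 119–121] -/
theorem TPairVocabulary.exists_degenerate_tpairFacts (R : GlobalAnabelianContext.{u}) (T : TKind)
    (hs : ∀ E, Subsingleton (R.proVal E).carrier) (hnon : ∀ E v, v ∉ (R.proVal E).non)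
    (harc : ∀ E v, v ∉ (R.proVal E).arc) :
    ∃ W : TPairVocabulary R T, ∃ A : PanalocalReconstruction W,
      (∀ hT : T ≠ .TLG, CyclotomeIsoUnique W hT ∧ ReferencePairIsoUnique W hT ∧
        TPairHomDeterminedByTheaterHom W hT ∧ TPairIsoCanonical W hT ∧ TPairEAHomExtends W hT) ∧
      (∀ hT : T = .TLG, CyclotomeIsoViaArchimedean W hT) ∧
      Cor52vi W ∧ (∀ hT : T ≠ .TLG, Cor52vii W A hT) := by
  let W₀ : TPairVocabulary R T :=
    { LocObj := Type u
      GlobObj := Type u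
      toGlob := 𝟭 (Type u)
      IsContLoc := fun _ => True
      IsContGlob := fun _ => True
      IsMLFGaloisPair := fun _ => True
      KummerStr := fun _ _ => PUnit.{u + 1}
      IsAutHolPair := fun _ => True
      kummerTransport := fun _ _ _ => PUnit.unit
      kummerTransport_refl := fun _ => rfl
      globData := fun _ => PUnit.{u + 1}
      globAct := fun _ => 1
      locDataNon := fun _ _ => PUnit.{u + 1}
      locDataArc := fun _ _ => PUnit.{u + 1}
      locAct := fun _ _ => 1
      locKummer := fun _ _ => PUnit.unit
      locRestrictNon := fun _ _ => 𝟙 _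
      locRestrictArc := fun _ _ => 𝟙 _
      cyclotome := fun _ => ProfiniteGrp.of PUnit.{u + 1}
      cyclotomeGrp := fun _ => ProfiniteGrp.of PUnit.{u + 1}
      IsCyclotomeCompatible := fun _ _ => True
      IsCyclotomeArchCompatible := fun _ _ => True
      ZIndex := PEmpty.{u + 1}
      IsGeomIsoTo := fun z _ => z.elim }
  -- every theater over `R` has no local elements
  have hTn : ∀ T₀ : GlobalGaloisTheater R, ∀ v, v ∉ T₀.V.non :=
    fun T₀ => (T₀.forall_notMem_of_forall_notMem hnon harc).1
  have hTa : ∀ T₀ : GlobalGaloisTheater R, ∀ v, v ∉ T₀.V.arc :=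
    fun T₀ => (T₀.forall_notMem_of_forall_notMem hnon harc).2
  -- the global datum of a global `T`-pair over `W₀` is a one-point type
  have hM : ∀ P : GlobalTPair W₀, Subsingleton P.M := fun P => by
    obtain ⟨-, -, -, -, ψ, -⟩ := P.exists_reference
    exact ⟨fun a b => by
      rw [← (CategoryTheory.Iso.toEquiv ψ).apply_symm_apply a,
        ← (CategoryTheory.Iso.toEquiv ψ).apply_symm_apply b]⟩
  let A₀ : PanalocalReconstruction W₀ :=
    { anabData := fun _ => PUnit.{u + 1}, anabAct := fun _ => 1,
      linHolData := fun _ => PUnit.{u + 1}, linHolKummer := fun _ => PUnit.unit }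
  -- every panalocal Galois-theater over `R` has no local elements
  have hPn : ∀ P : PanalocalGaloisTheater R, ∀ v, v ∉ P.non :=
    fun P => (P.forall_notMem_of_forall_notMem hnon harc).1
  have hPa : ∀ P : PanalocalGaloisTheater R, ∀ v, v ∉ P.arc :=
    fun P => (P.forall_notMem_of_forall_notMem hnon harc).2.1
  refine ⟨W₀, A₀, fun hT => ⟨?_, ?_, ?_, ?_, ?_⟩, fun hT P _ => ⟨ContinuousMulEquiv.refl _, trivial⟩,
    ⟨?_, ?_, ?_⟩, fun hT => ⟨?_, ?_, ?_⟩⟩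
  · -- Cor 5.2 (ii): the trivial cyclotomes have exactly one isomorphism
    intro P
    exact ⟨ContinuousMulEquiv.refl _, trivial,
      fun ι _ => ContinuousMulEquiv.ext fun x => Subsingleton.elim (α := PUnit) _ _⟩
  · -- Cor 5.2 (iii), first half
    intro P ψV _ hn ha ψ ψ' ψnon ψnon' ψarc ψarc' _ _
    haveI := hM P
    refine ⟨?_, funext fun v => (hnon P.theater.ext v v.2).elim, funext fun v => (harc P.theater.ext v v.2).elim⟩
    ext x
    exact Subsingleton.elim _ _
  · -- Cor 5.2 (iii), second half
    intro P₁ P₂ φ φ' h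
    haveI := hM P₂
    obtain ⟨φV, φM, hφM, non_mem, arc_mem, φnon, hφnon, φarc, hφarc, hρn, hρa⟩ := φ
    obtain ⟨φV', φM', hφM', non_mem', arc_mem', φnon', hφnon', φarc', hφarc', hρn', hρa'⟩ := φ'
    cases h
    refine ⟨?_, ?_, ?_⟩
    · ext x
      exact Subsingleton.elim _ _
    · exact heq_of_eq (funext fun v => (hTn P₁.theater v v.2).elim)
    · exact heq_of_eq (funext fun v => (hTa P₁.theater v v.2).elim)
  · -- Cor 5.2 (iv), essential surjectivity
    intro P
    obtain ⟨ψV, hψV, hn, ha, ψ, ψnon, ψarc, hact, hactNon, -, hρnon, -⟩ := P.exists_reference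
    obtain ⟨hsmul, hgen, hnon', harc', -⟩ := hψV
    refine ⟨trivial, fun _ => trivial, fun _ => trivial,
      { φV :=
          { φgrp := 𝟙 P.theater.ext
            isEAHom := isEAHom_id P.theater.ext
            φV := ψV
            φV_smul := hsmul
            φV_generic := hgen
            image_non := hnon'
            image_arc := harc'
            arch_compat := fun v _ => (harc P.theater.ext v.1 v.2).elim }
        φM := ψ
        φM_equivariant := hact
        non_mem := hn
        arc_mem := ha
        φnon := ψnon
        φnon_equivariant := fun v g hg hg' => hactNon v g hg hg'
        φarc := ψarc
        φarc_kummer := fun v => (harc P.theater.ext v.1 v.2).elim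
        ρnon_comm := hρnon
        ρarc_comm := fun v => (harc P.theater.ext v.1 v.2).elim }, rfl⟩
  · -- Cor 5.2 (iv), full faithfulness
    intro E₁ E₂ h₁ h₂ _ _ _ _ _ _ f hf
    refine ⟨{ φV :=
                { φgrp := f
                  isEAHom := hf
                  φV := R.mapProVal f hf
                  φV_smul := R.mapProVal_smul f hf
                  φV_generic := @Subsingleton.elim _ (hs E₂) _ _
                  image_non := by
                    change (R.mapProVal f hf) '' (R.proVal E₁).non = (R.proVal E₂).non
                    rw [Set.eq_empty_iff_forall_notMem.mpr (hnon E₁), Set.eq_empty_iff_forall_notMem.mpr (hnon E₂),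
                      Set.image_empty]
                  image_arc := by
                    change (R.mapProVal f hf) '' (R.proVal E₁).arc = (R.proVal E₂).arc
                    rw [Set.eq_empty_iff_forall_notMem.mpr (harc E₁), Set.eq_empty_iff_forall_notMem.mpr (harc E₂),
                      Set.image_empty]
                  arch_compat := fun v _ => (harc E₁ v.1 v.2).elim }
              φM := Iso.refl _
              φM_equivariant := fun _ => rfl
              non_mem := fun v => (hnon E₁ v.1 v.2).elim
              arc_mem := fun v => (harc E₁ v.1 v.2).elim
              φnon := fun v => (hnon E₁ v.1 v.2).elim
              φnon_equivariant := fun v => (hnon E₁ v.1 v.2).elim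
              φarc := fun v => (harc E₁ v.1 v.2).elim
              φarc_kummer := fun v => (harc E₁ v.1 v.2).elim
              ρnon_comm := fun v => (hnon E₁ v.1 v.2).elim
              ρarc_comm := fun v => (harc E₁ v.1 v.2).elim }, rfl⟩

  · -- Cor 5.2 (vi), object part: the one-point panalocalization with `PUnit` local data
    intro M
    obtain ⟨P, hE, ψ, hψ⟩ :=
      panalocalizationExists_of_forall_notMem R hnon harc M.theater.ext M.theater.isAdmissible
    obtain ⟨ψV, hψV⟩ := M.theater.exists_referenceIso
    refine ⟨{ theater := P
              data := { Mnon := fun _ => PUnit.{u + 1}, actNon := fun _ => 1, isMLF := fun _ => trivial,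
                        Marc := fun _ => PUnit.{u + 1}, kummer := fun _ => PUnit.unit,
                        isAutHol := fun _ => trivial } },
      ψV, hψV, ψ, hψ, fun vl hvl => ?_, fun vl hvl => ?_⟩
    · exact ((M.theater.forall_notMem_of_forall_notMem hnon harc).1 _ hvl).elim
    · exact ((M.theater.forall_notMem_of_forall_notMem hnon harc).2 _ hvl).elim
  · -- Cor 5.2 (vi), morphism part (weak form)
    intro M₁ M₂ Q₁ Q₂ h₁ h₂ φ
    obtain ⟨ψV₁, hψV₁, ψ₁, hψ₁, -⟩ := h₁
    obtain ⟨ψV₂, hψV₂, ψ₂, hψ₂, -⟩ := h₂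
    obtain ⟨φP⟩ := panalocalizationMapsHom_of_forall_notMem R hnon harc M₁.theater.ext M₂.theater.ext
      Q₁.theater Q₂.theater ⟨M₁.theater.isAdmissible, ψ₁, hψ₁⟩ ⟨M₂.theater.isAdmissible, ψ₂, hψ₂⟩
      φ.φV.φgrp φ.φV.isEAHom
    exact ⟨{ φV := φP
             φnon := fun v => (hPn Q₁.theater v.1 v.2).elim
             φnon_equivariant := fun v => (hPn Q₁.theater v.1 v.2).elim
             φarc := fun v => (hPa Q₁.theater v.1 v.2).elim
             φarc_kummer := fun v => (hPa Q₁.theater v.1 v.2).elim }⟩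
  · -- Cor 5.2 (vi), essential surjectivity: `Q` is the panalocalization of the canonical global `T`-pair
    intro Q
    obtain ⟨E, hE, ψ, hψ⟩ := Q.theater.exists_reference
    refine ⟨W₀.canonical E hE trivial (fun _ => trivial) (fun _ => trivial), Homeomorph.refl _,
      R.refl_isReferenceIsoFor E, ψ, hψ, fun vl hvl => (hnon E vl hvl).elim, fun vl hvl => (harc E vl hvl).elim⟩
  · -- Cor 5.2 (vii), essential surjectivity over the identity of the panalocal theater
    intro Q
    exact ⟨fun _ => trivial, fun _ => trivial,
      { φV := PanalocalGaloisTheater.Hom.refl Q.theater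
        φnon := fun v => (hPn Q.theater v.1 v.2).elim
        φnon_equivariant := fun v => (hPn Q.theater v.1 v.2).elim
        φarc := fun v => (hPa Q.theater v.1 v.2).elim
        φarc_kummer := fun v => (hPa Q.theater v.1 v.2).elim }, rfl⟩
  · -- Cor 5.2 (vii), faithfulness: the local components live over EMPTY index sets
    intro Q₁ Q₂ φ φ' h
    obtain ⟨a, b, c, d, e⟩ := φ
    obtain ⟨a', b', c', d', e'⟩ := φ'
    cases h
    have hb : b = b' := funext fun v => (hPn Q₁.theater v.1 v.2).elim
    have hd : d = d' := funext fun v => (hPa Q₁.theater v.1 v.2).elim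
    subst hb hd
    rfl
  · -- Cor 5.2 (vii), fullness
    intro Q₁ Q₂ f _
    exact ⟨{ φV := f
             φnon := fun v => (hPn Q₁.theater v.1 v.2).elim
             φnon_equivariant := fun v => (hPn Q₁.theater v.1 v.2).elim
             φarc := fun v => (hPa Q₁.theater v.1 v.2).elim
             φarc_kummer := fun v => (hPa Q₁.theater v.1 v.2).elim }, rfl⟩

/-- **At the trivial-group context** (`GlobalAnabelianContext.exists_trivialGroupContext`): there are `R`, `W`, `A`
with `Ob(EA⊚)` and `GlobalTPair W` inhabited and the `T`-pair named facts of `TPairs.lean` / `PanalocalTPairs.lean`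
holding as in `TPairVocabulary.exists_degenerate_tpairFacts`.  SATISFIABILITY witness, DEGENERATE model.
[cite: MochizukiAbsTopIII2015, Cor 5.2 (ii)–(vii) pp. 119–121] -/
theorem TPairVocabulary.exists_context_tpairFacts (T : TKind) :
    ∃ (R : GlobalAnabelianContext.{u}) (W : TPairVocabulary R T) (A : PanalocalReconstruction W),
      (∃ E, R.IsAdmissible E) ∧ Nonempty (GlobalTPair W) ∧
      (∀ hT : T ≠ .TLG, CyclotomeIsoUnique W hT ∧ ReferencePairIsoUnique W hT ∧
        TPairHomDeterminedByTheaterHom W hT ∧ TPairIsoCanonical W hT ∧ TPairEAHomExtends W hT) ∧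
      (∀ hT : T = .TLG, CyclotomeIsoViaArchimedean W hT) ∧
      Cor52vi W ∧ (∀ hT : T ≠ .TLG, Cor52vii W A hT) := by
  obtain ⟨R, hadm, hs, hnon, harc⟩ := GlobalAnabelianContext.exists_trivialGroupContext.{u}
  obtain ⟨W, A, h₁, h₂, h₃, h₄⟩ := TPairVocabulary.exists_degenerate_tpairFacts R T hs hnon harc
  let E₁ : FundamentalExtension.{u} :=
    { arith := ProfiniteGrp.of PUnit.{u + 1}, gal := ProfiniteGrp.of PUnit.{u + 1},
      aug := ContinuousMonoidHom.id _, aug_surjective := Function.surjective_id }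
  have hE₁ : R.IsAdmissible E₁ := (hadm _).mpr (inferInstanceAs (Subsingleton PUnit))
  obtain ⟨P, -⟩ := panalocalizationExists_of_forall_notMem R hnon harc E₁ hE₁
  have hPn := (P.forall_notMem_of_forall_notMem hnon harc).1
  have hPa := (P.forall_notMem_of_forall_notMem hnon harc).2.1
  obtain ⟨M, -⟩ := h₃.2.2 (A.canonical P (fun v => (hPn v.1 v.2).elim) (fun v => (hPa v.1 v.2).elim))
  exact ⟨R, W, A, ⟨E₁, hE₁⟩, ⟨M⟩, h₁, h₂, h₃, h₄⟩

end Literature.AnabelianGeometry.AbsoluteAnabelian
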